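import Summits.ABC.IUTFork.Cor312GlueReglueBalls
import Summits.ABC.IUTFork.Cor312GlueReglue
import HarnessLib

/-!
# [IUTchIII] Cor. 3.12 — NON-VACUITY of the uniform (G3) theorem: typed Thm 3.11 holds, the Θ-glue decides Cor 3.12

Record-only file (D-0012) of the abc-iut cell (Cor. 3.12 cone, D-0067; companion of `Cor312GlueReglue`, wave-5 seat
abc-iut-w5-d177); TAKES NO SIDE; toy constructions and theorems, no `Prop` fact.

`Cor312GlueReglue.exists_reglue_not_statement` shows: whenever a verbatim setting `P` with `BridgeHyps P` and
`|log(q)| > 0` has, at one packet, (Ind1),(Ind2)-stable hull-sets admitting a hull of arbitrarily negative log-volume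
(`SmallStableHullSets`), the Θ-glue can be re-chosen at that packet so that the typed Corollary 3.12 fails — over the
SAME Theorem 3.11 instance. THIS FILE shows those premises hold TOGETHER WITH the typed Theorem 3.11, over EVERY
index skeleton `T` and place `v_ℚ⁰`, on the `ℚ`-line packets with the nested-ball frames of `Cor312GlueReglueBalls`:
* `full` / `full_statement` — a `FullSituation` (admissible = escapes some ball; log-volume `vol`; the toy link data
  of the witnesses of record) satisfying the typed Theorem 3.11 (i) ∧ (ii) ∧ (iii);
* `setting` — over it, Θ-glue = `q`-glue = the packet: `bridgeHyps`, `absLogQPos` (`−|log(q)| = −1`), and the typed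
  Corollary HOLDS here (`statement`, with equality); `smallStableHullSets` — the re-gluing hypothesis holds at every
  packet over `v_ℚ⁰` (the balls are stable by `coord_indGroup`, of volume `−1 − n`);
* **`exists_reglue_breaks`**, **`thm311_holds_cor312_undecided`** — hence (by `Cor312GlueReglue`) a re-gluing at ONE
  packet, over the same full situation, keeps every bridge hypothesis and `|log(q)| > 0` and VIOLATES the typed
  Corollary: one Theorem 3.11 instance, two glues, opposite verdicts.
HONEST SCOPE: toy carriers and link data as in the witnesses of record; interface-level; no side taken.
[claim: Mochizuki2012, status: disputed]
-/


noncomputable section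

open scoped Classical

namespace Summit.ABC

namespace IUTFork

namespace Cor312Vol

namespace GlueReglueWitness

open Thm311 Cor312 Cor312.Checks Cor312.Setting Cor312Vol.GapWitness Cor312Vol.GapWitnessProv
  Literature.IUT.LogThetaLattice

open GlueReglueBalls

variable {T : ThetaIndex} (vQ₀ : T.VQ)

/-! ## 3. The data, the column, and the typed Theorem 3.11 -/

/-- Data (a)(b)(c): integral structures = packet, ADMISSIBLE = escapes some ball, log-volume `vol`, no splitting
monoid, no number field (as in the witnesses of record). [folklore] -/
def data : MRData (lineShells T) where
  shellPk := fun _ _ => Set.univ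
  shellSub := fun _ _ => Set.univ
  Adm := fun j vQ A => ∃ n, ¬ A ⊆ ball j vQ n
  logvol := fun j vQ A => vol vQ₀ j vQ A
  Ψ := fun _ _ => ∅
  act := fun _ _ _ => 0
  Mmod := fun _ => ∅

/-- Global degrees: one object per label, degree `−1`, region everything. [folklore] -/
def degrees (j : T.LabelStar) : GlobalDegrees (lineShells T) j where
  ObjMOD := Unit
  Objmod := Unit
  natIso := Equiv.refl Unit
  deg := fun _ => -1
  region := fun _ _ => Set.univ

/-- The situation: the same data on every vertical line. [folklore] -/
def situation : Situation T where
  L := lineShells T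
  D := fun _ => data vQ₀
  G := fun _ j => degrees j

/-- The column: transported data = the coric data, unit/ball images everything, one-point pilot objects. [folklore] -/
def column : Column (lineShells T) where
  frobAdm := fun _ j vQ A => ∃ n, ¬ A ⊆ ball j vQ n
  frobLogvol := fun _ j vQ A => vol vQ₀ j vQ A
  frobΨ := fun _ _ _ => ∅
  frobMmod := fun _ _ => ∅
  unitImage := fun _ _ _ _ => Set.univ
  ballImage := fun _ _ _ => Set.univ
  ObjLGP := Unit
  frobObjLGP := fun _ => Unit
  kumLGP := fun _ => Equiv.refl Unit
  ObjLgp := Unit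
  frobObjLgp := fun _ => Unit
  kumLgp := fun _ => Equiv.refl Unit
  thetaPilot := fun _ => ()

/-- The full situation (link data = `GapWitness.gapLink`). [folklore] -/
def full : FullSituation T where
  toSituation := situation vQ₀
  col := fun _ => column vQ₀
  link := gapLink

/-- `Σ_{v_ℚ} vol(packet) = −1` (one term, at `v_ℚ⁰`). [folklore] -/
theorem finsum_vol_univ (j : T.Label) :
    (∑ᶠ vQ : T.VQ, vol vQ₀ j vQ (Set.univ : Set ((lineShells T).Packet j vQ))) = -1 := by
  rw [finsum_eq_single _ vQ₀ fun vQ hvQ => vol_of_ne vQ₀ hvQ _]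
  exact vol_univ_self vQ₀ j

/-- (i) holds: no splitting monoid; degree clause `−1 = −1` with admissible regions; all classes coincide. [folklore] -/
theorem partI : (full vQ₀).PartI := by
  refine ⟨fun n v hv x hx => absurd hx (Set.notMem_empty x), fun n j J =>
    ⟨fun vQ => ⟨0, univ_not_subset_ball _ vQ 0⟩, support_finite_of_ne vQ₀ fun vQ hvQ => vol_of_ne vQ₀ hvQ _,
      (finsum_vol_univ vQ₀ j.1).symm⟩, fun n n' => rfl⟩

/-- (ii) holds: transported data = coric data; (Ind3) in the (total) integral structures. [folklore] -/
theorem partII : (full vQ₀).toLatticeSituation.PartII := by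
  intro n
  refine (Column.partII_iff _ _).2 ⟨fun m j vQ A h => ⟨h, rfl⟩, fun _ _ _ => rfl, fun _ _ => rfl, ?_⟩
  exact ⟨fun m m' j vQ _ => Set.subset_univ _,
    fun m j vQ _ => ⟨Set.subset_univ _, Set.subset_univ _, fun _ _ => Set.subset_univ _⟩⟩

/-- (iii) holds (`gapLink`). [folklore] -/
theorem partIII : (full vQ₀).PartIII := by
  refine ⟨gapLink.partIIIa_holds, gapLink.partIIIb_holds, ?_, ?_,
    (full vQ₀).evalCompatUpToInd_of_multiradialCompat (partI vQ₀).2.2⟩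
  · exact gapLink.partIIIc_of_full (fun _ => rfl) fun n m => by rintro p ⟨a, rfl⟩; rfl
  · intro n m; exact Thm311.PolyIsoCalc.stabilized_full _ _

/-- **The typed Theorem 3.11 (i) ∧ (ii) ∧ (iii) HOLDS in the witness.** [folklore] -/
theorem full_statement : (full vQ₀).Statement := ⟨partI vQ₀, partII vQ₀, partIII vQ₀⟩

/-! ## 4. The setting: both glues = the packet; its quantities; bridge hypotheses; small stable hull-sets -/

/-- The SETTING over `situation`: lattice `(n, m)`, one-point pilots, the nested-ball frame, Θ-glue = `q`-glue = the
whole packet (so here the typed Corollary holds with equality — the base point of the re-gluing). [folklore] -/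
def setting : Setting (situation vQ₀) where
  n := 0
  HT := ℤ × ℤ
  LogLink := fun _ _ => Unit
  IsFull := fun _ => True
  lattice :=
    { theater := fun n m => (n, m)
      distinct := fun p q h => by simpa using h
      logLink := fun _ _ => ()
      logLink_full := fun _ _ => trivial }
  Frd := Unit
  IsoF := fun _ _ => Unit
  Ob := fun _ => Unit
  realify := id
  Strip := Unit
  IsoS := fun _ _ => Unit
  M := fun _ _ => Unit
  sig := pointSig
  split := { Msplit := fun _ _ => ⊤, exists_gen := fun _ _ => ⟨⟨(), trivial⟩, top_unit_isGenerator _⟩ }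
  ObΔ := Unit
  N := fun _ _ => Unit
  qData := { q := fun _ _ => (), q_gen := fun _ _ => unit_isGenerator _, objOf := fun _ => () }
  frame := fun j vQ => frame j vQ
  hul_adm := fun j vQ H hH => by
    rcases (mem_frame_hul_iff H).1 hH with rfl | ⟨n, rfl⟩
    · exact ⟨0, univ_not_subset_ball j vQ 0⟩
    · exact ⟨n + 1, ball_not_subset_succ j vQ n⟩
  thetaRegionOf := fun _ _ _ _ => Set.univ
  qRegionOf := fun _ _ _ => Set.univ
  qRegion_mem := fun _ _ => Set.mem_insert _ _
  qSupport_finite := fun _ => support_finite_of_ne vQ₀ fun vQ hvQ => vol_of_ne vQ₀ hvQ _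

/-- The (Ind3)-enlarged Θ-region is the packet. [folklore] -/
theorem thetaRegion3_eq (j : T.Label) (vQ : T.VQ) : (setting vQ₀).thetaRegion3 j vQ = Set.univ :=
  show (⋃ _ : ℤ, (Set.univ : Set ((lineShells T).Packet j vQ))) = Set.univ from Set.iUnion_const _

/-- The possible images are exactly `{packet}` (every indeterminacy is bijective). [folklore] -/
theorem possibleImages_eq (j : T.Label) (vQ : T.VQ) :
    (setting vQ₀).possibleImages j vQ = {Set.univ} := by
  refine Set.eq_singleton_iff_unique_mem.2 ⟨?_, ?_⟩
  · exact thetaRegion3_eq vQ₀ j vQ ▸ (setting vQ₀).thetaRegion3_mem_possibleImages j vQ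
  · rintro U ⟨Φ, -, rfl⟩
    rw [thetaRegion3_eq]
    exact Set.image_univ_of_surjective (Φ j vQ).surjective

/-- The union of the possible images is the packet. [folklore] -/
theorem sUnion_possibleImages (j : T.Label) (vQ : T.VQ) :
    ⋃₀ (setting vQ₀).possibleImages j vQ = Set.univ := by
  rw [possibleImages_eq, Set.sUnion_singleton]

/-- The packet hull of the union of the possible images is the packet. [folklore] -/
theorem thetaHull_eq (j : T.Label) (vQ : T.VQ) : (setting vQ₀).thetaHull j vQ = Set.univ := by
  unfold Setting.thetaHull
  rw [sUnion_possibleImages]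
  exact frame_hull_univ j vQ

/-- Every packet union admits its hull (the packet escapes `ball 0`). [folklore] -/
theorem hullDefined (j : T.Label) (vQ : T.VQ) : (setting vQ₀).HullDefined j vQ := by
  unfold Setting.HullDefined
  rw [sUnion_possibleImages]
  exact ⟨trivial, ⟨0, univ_not_subset_ball j vQ 0⟩⟩

/-- The local Θ-volume is `vol(packet)`: `−1` at `v_ℚ⁰`, `0` elsewhere. [folklore] -/
theorem thetaLocal_eq (j : T.Label) (vQ : T.VQ) :
    (setting vQ₀).thetaLocal j vQ =
      ((vol vQ₀ j vQ (Set.univ : Set ((lineShells T).Packet j vQ)) : ℝ) : WithTop ℝ) := by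
  unfold Setting.thetaLocal
  rw [if_pos (hullDefined vQ₀ j vQ), thetaHull_eq]
  rfl

/-- The witness is `ThetaFinite`. [folklore] -/
theorem thetaFinite : (setting vQ₀).ThetaFinite :=
  ⟨fun i vQ => by rw [thetaLocal_eq]; exact WithTop.coe_ne_top, fun i =>
    support_finite_of_ne vQ₀ fun vQ hvQ => by rw [thetaLocal_eq, WithTop.untopD_coe, vol_of_ne vQ₀ hvQ]⟩

/-- `−|log(Θ)| = −1`. [folklore] -/
theorem negLogTheta_eq : (setting vQ₀).negLogTheta = ((-1 : ℝ) : WithTop ℝ) := by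
  unfold Setting.negLogTheta
  rw [if_pos (thetaFinite vQ₀)]
  have h : ∀ i : Fin T.lstar,
      (∑ᶠ vQ : T.VQ, ((setting vQ₀).thetaLocal (Setting.labelSucc i) vQ).untopD 0) = -1 := by
    intro i
    have h1 : (fun vQ : T.VQ => ((setting vQ₀).thetaLocal (Setting.labelSucc i) vQ).untopD 0) =
        fun vQ => vol vQ₀ (Setting.labelSucc i) vQ Set.univ := by
      funext vQ
      rw [thetaLocal_eq, WithTop.untopD_coe]
    rw [h1]
    exact finsum_vol_univ vQ₀ _
  simp only [h]
  exact congrArg _ (processionNormalized_const (lt_of_lt_of_le two_pos T.two_le_lstar) _)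

/-- `−|log(q)| = −1`. [folklore] -/
theorem negLogQ_eq : (setting vQ₀).negLogQ = -1 := by
  unfold Setting.negLogQ
  have h : ∀ i : Fin T.lstar,
      (∑ᶠ vQ : T.VQ, (setting vQ₀).qLocal (Setting.labelSucc i) vQ) = -1 := fun i =>
    finsum_vol_univ vQ₀ _
  simp only [h]
  exact processionNormalized_const (lt_of_lt_of_le two_pos T.two_le_lstar) _

/-- `|log(q)| > 0`. [folklore] -/
theorem absLogQPos : (setting vQ₀).AbsLogQPos := by
  show (setting vQ₀).negLogQ < 0
  rw [negLogQ_eq]; norm_num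

/-- At the base point the typed Corollary 3.12 HOLDS (with equality `−1 ≤ −1`). [folklore] -/
theorem statement : (setting vQ₀).Statement := by
  refine ⟨by rw [negLogTheta_eq]; exact WithTop.coe_ne_top, ?_⟩
  rw [negLogQ_eq, negLogTheta_eq]

/-- **All bridge hypotheses hold**: monotonicity on ADMISSIBLE regions (`vol_mono`), admissible possible images,
finitely supported global choices (every choice is the packet everywhere), nonempty hull-sets and Θ-regions,
`ThetaFinite`. [folklore] -/
theorem bridgeHyps : BridgeHyps (setting vQ₀) where
  mono := fun _ vQ _ _ hA _ hAB => vol_mono vQ₀ hAB hA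
  image_adm := fun i vQ U hU => by
    rw [possibleImages_eq, Set.mem_singleton_iff] at hU
    subst hU
    exact ⟨0, univ_not_subset_ball _ vQ 0⟩
  image_fin := fun U => by
    have hU : ∀ t : Fin T.lstar × T.VQ, U.1 t = Set.univ := fun t => by
      have h := U.2 t
      rw [possibleImages_eq, Set.mem_singleton_iff] at h
      exact h
    refine (Set.finite_univ.prod (Set.finite_singleton vQ₀)).subset fun t ht => ?_
    refine Set.mem_prod.2 ⟨Set.mem_univ _, ?_⟩
    by_contra hne
    apply ht
    show (1 / (T.lstar : ℝ)) * vol vQ₀ (Setting.labelSucc t.1) t.2 (U.1 t) = 0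
    rw [vol_of_ne vQ₀ hne, mul_zero]
  hul_nonempty := fun j vQ H hH => by
    rcases (mem_frame_hul_iff H).1 hH with rfl | ⟨n, rfl⟩
    · exact ⟨0, Set.mem_univ _⟩
    · exact ⟨0, zero_mem_ball j vQ n⟩
  theta_nonempty := fun i vQ => by
    rw [thetaRegion3_eq]
    exact ⟨0, Set.mem_univ _⟩
  finite := thetaFinite vQ₀

/-- **Small stable hull-sets at every packet over `v_ℚ⁰`** — the hypothesis `SmallStableHullSets` of
`Cor312GlueReglue.exists_reglue_not_statement`, here in unfolded form: for every `c` a hull-set admitting a hull,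
STABLE under the whole (Ind1),(Ind2)-group (`image_eq_of_mem_closure`), of log-volume `< c` (`ball n`, `−1 − n < c`).
[folklore] -/
theorem smallStable (j : T.Label) (c : ℝ) :
    ∃ R₀ : Set ((lineShells T).Packet j vQ₀), R₀ ∈ ((setting vQ₀).frame j vQ₀).Hul ∧
      ((setting vQ₀).frame j vQ₀).HasHull R₀ ∧
      (∀ Φ ∈ Setting.indGroup (situation vQ₀), Φ j vQ₀ '' R₀ = R₀) ∧
      ((situation vQ₀).D (setting vQ₀).n).logvol j vQ₀ R₀ < c := by
  obtain ⟨n, hn⟩ := exists_nat_gt (-1 - c)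
  refine ⟨ball j vQ₀ n, Set.mem_insert_of_mem _ ⟨n, rfl⟩, ⟨n + 1, ball_not_subset_succ j vQ₀ n⟩,
    fun Φ hΦ => image_eq_of_mem_closure hΦ j vQ₀ (fun q => |q| * (2 : ℚ) ^ n ≤ 1), ?_⟩
  show vol vQ₀ j vQ₀ (ball j vQ₀ n) < c
  rw [vol_ball]
  linarith

/-- **NON-VACUITY of the premises of the uniform (G3) theorem, jointly with typed Thm 3.11**: over every index
skeleton and place, a full situation satisfying the typed Theorem 3.11 and a setting over it satisfying every
bridge hypothesis, `|log(q)| > 0`, and — at every packet over `v_ℚ⁰` — the small-stable-hull-sets hypothesis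
(unfolded). [folklore] -/
theorem premises_satisfiable (j : T.Label) :
    (full vQ₀).Statement ∧ BridgeHyps (setting vQ₀) ∧ (setting vQ₀).AbsLogQPos ∧
      ∀ c : ℝ, ∃ R₀ : Set ((lineShells T).Packet j vQ₀), R₀ ∈ ((setting vQ₀).frame j vQ₀).Hul ∧
        ((setting vQ₀).frame j vQ₀).HasHull R₀ ∧
        (∀ Φ ∈ Setting.indGroup (situation vQ₀), Φ j vQ₀ '' R₀ = R₀) ∧
        ((situation vQ₀).D (setting vQ₀).n).logvol j vQ₀ R₀ < c :=
  ⟨full_statement vQ₀, bridgeHyps vQ₀, absLogQPos vQ₀, smallStable vQ₀ j⟩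

/-! ## 5. The uniform (G3) theorem applied: re-gluing ONE packet breaks the Corollary here -/

/-- The hypothesis `SmallStableHullSets` of `Cor312GlueReglue` HOLDS at every packet over `v_ℚ⁰`. [folklore] -/
theorem smallStableHullSets (j : T.Label) : (setting vQ₀).SmallStableHullSets j vQ₀ := smallStable vQ₀ j

/-- **Re-gluing one packet breaks the typed Corollary 3.12 here** (`Cor312GlueReglue.exists_reglue_not_statement`
applied to the base setting): some re-gluing at `(labelSucc i₀, v_ℚ⁰)` keeps every bridge hypothesis and
`|log(q)| > 0` and violates `Statement` — over the same full situation, for which typed Thm 3.11 holds. [folklore] -/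
theorem exists_reglue_breaks (i₀ : Fin T.lstar) :
    ∃ R : ∀ (j : T.Label) (vQ : T.VQ), Set ((lineShells T).Packet j vQ),
      BridgeHyps ((setting vQ₀).reglue (labelSucc i₀) vQ₀ R) ∧
        ((setting vQ₀).reglue (labelSucc i₀) vQ₀ R).AbsLogQPos ∧
          ¬ ((setting vQ₀).reglue (labelSucc i₀) vQ₀ R).Statement :=
  exists_reglue_not_statement (bridgeHyps vQ₀) (absLogQPos vQ₀) i₀ vQ₀ (smallStableHullSets vQ₀ _)

/-- **HEADLINE (non-vacuous uniform (G3), over EVERY index skeleton `T` and place `v_ℚ⁰`).** One full situation for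
which the typed Theorem 3.11 (i)∧(ii)∧(iii) HOLDS carries BOTH a bridge-admissible setting with `|log(q)| > 0`
satisfying the typed Corollary 3.12 AND one — differing from it only in the Θ-glue at ONE packet — violating it:
the typed Theorem 3.11 instance does not decide the typed Corollary; the Θ-glue does. Interface-level; no side
taken on [IUTchIII] Cor. 3.12. [claim: Mochizuki2012, status: disputed] -/
theorem thm311_holds_cor312_undecided (i₀ : Fin T.lstar) :
    (full vQ₀).Statement ∧
      (BridgeHyps (setting vQ₀) ∧ (setting vQ₀).AbsLogQPos ∧ (setting vQ₀).Statement) ∧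
        ∃ P' : Setting (full vQ₀).toLatticeSituation.toSituation,
          (∃ R, P' = (setting vQ₀).reglue (labelSucc i₀) vQ₀ R) ∧
            BridgeHyps P' ∧ P'.AbsLogQPos ∧ ¬ P'.Statement := by
  obtain ⟨R, hB, hq, hns⟩ := exists_reglue_breaks vQ₀ i₀
  exact ⟨full_statement vQ₀, ⟨bridgeHyps vQ₀, absLogQPos vQ₀, statement vQ₀⟩,
    ⟨(setting vQ₀).reglue (labelSucc i₀) vQ₀ R, ⟨R, rfl⟩, hB, hq, hns⟩⟩

end GlueReglueWitness

end Cor312Vol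

end IUTFork

end Summit.ABC

end
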